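import Literature.MathematicalPhysics.QuantumLattice.XXZGroundStateSpontaneousOrder
import Literature.MathematicalPhysics.QuantumLattice.HardCoreBosonGroundStateBEC
import Literature.MathematicalPhysics.QuantumLattice.HardCoreBosonBECPhaseNoGap
import HarnessLib

/-!
# Spontaneous `U(1)` (gauge) symmetry breaking in the GROUND STATES of the hard-core lattice Bose gas in a
# staggered field: Koma–Tasaki 1993 Theorem 7.3 for `hardCoreLatticeGas d L λ`

Topic `MathematicalPhysics/QuantumLattice`; companion of `XXZGroundStateSpontaneousOrder.lean` (the same theorem for
Koma–Tasaki's own models, among them the pure hard-core gas `λ = 0` = the spin-½ XY model,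
`XXZKT.hardCoreBoson_ground_spontaneousOrder(_spinHalf_two)`) and of `HardCoreBosonGroundStateBEC.lean` (ground-state
Bose–Einstein condensation = off-diagonal long-range order of the model, `d ≥ 2`, small `λ ≥ 0`, INCLUDING `d = 2`).

The model (Aizenman–Lieb–Seiringer–Solovej–Yngvason 2004, the tree's
`Literature.Barriers.AtomisticToContinuum.BoseGas.hardCoreLatticeGas d L λ`): hard-core bosons at half filling on the
torus `Λ = (ℤ/Lℤ)^d` in the staggered ("optical super-lattice") potential `λ(-1)^x`, in Matsubara–Matsuda spin language
`H = -Σ_{⟨x,y⟩}(S¹_xS¹_y + S²_xS²_y) + λΣ_x(½ + (-1)^xS³_x)`; the `U(1)` = particle-number symmetry is generated by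
`C = S³_tot` (`[H, S³_tot] = 0`, `HardCoreBoson.commute_hardCoreLatticeGas_totalSpin`), the condensate order operator is
`O^{(1)} = S¹_tot = ½Σ_x(a_x + a†_x)`, `O^{(2)} = S²_tot`.

T. Koma, H. Tasaki, *Symmetry breaking in Heisenberg antiferromagnets*, Commun. Math. Phys. **158** (1993) 191–214,
§7, p. 211: "Theorem 7.3 … can be proved only assuming a `U(1)` invariance. Since this allows one to apply the theorem
to a larger class of models (including, for example, the electron pair condensation problems in lattice electron
systems), we shall make the condition explicit. Here we only need one generator `X^{(3)}_Λ = C_Λ` and two component order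
operator `(O^{(1)}_Λ, O^{(2)}_Λ)`. … **Theorem 7.3.** Assume that the conditions for Theorem 7.1 are valid, and we further
have the `U(1)` invariance as discussed above. Also assume that `σ` defined in (7.1)
[`σ = lim_Λ N⁻¹√(Φ_Λ,(O_Λ)²Φ_Λ)`] is nonvanishing. Then
`liminf_{B↓0} liminf_{Λ↑ℤ^d} N⁻¹(Φ_Λ(B), O^{(1)}_ΛΦ_Λ(B)) ≥ √2 σ` (7.11)", `Φ_Λ(B)` any ground state of
`H_Λ(B) = H_Λ - BO^{(1)}_Λ` (2.6).  (Also KT93 §6 Remark, p. 208: "The most important of these extensions are the models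
with an `SO(2) = U(1)` invariance, where we get a factor `√2`.")  The abstract theorem is PROVED in the tree
(`KomaTasaki.komaTasakiU1Field_u1`); M. Aizenman et al., Phys. Rev. A **70** (2004) 023612, §2: "Bose–Einstein
condensation … for small `λ` … For `d = 2` this is true only in the ground state" — PROVED in the tree in the form of
an eventual floor `|Λ|⁻²Σ_{x,y}γ_∞(x,y) ≥ c > 0` of the ground-state one-particle density matrix
(`hardCoreLatticeGas_groundState_bec`, `hardCoreLatticeGas_groundState_lroSeq_ge_two`: `d = 2`, `0 ≤ λ ≤ 1/40`,
`c = 1/250`).  This file puts the two together.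

## What this file proves (2 small definitions + 1 structure instance, 0 named facts, 0 sorry)

* §1 the local Hamiltonians `h_x = -(½)Σ_{y∼x}(S¹_xS¹_y + S²_xS²_y) + λ(½·1 + (-1)^xS³_x)` (`HardCoreKT.localHam`,
  on-site part `HardCoreKT.onSite`): `Σ_x h_x = hardCoreLatticeGas d L λ` (`sum_localHam`), Hermitian, the uniform bound
  `‖h_x‖ ≤ h̄ = hbar_XY + |λ|(½ + s)` (`norm_localHam_le`, `s = sNorm 1 = 3/2`), locality `[h_x, (-1)^{σy}S^α_y] = 0`
  for `y ∉ nbhd x` (`commute_localHam_ktDensity`).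
* §2 **`HardCoreKT.u1System d L λ σ`**: the hard-core lattice gas as a Koma–Tasaki `U(1)` system (KT93 §2 ii)–v) and
  (2.12), (2.14): `C = S³_tot`, `o^{(1)}_x = (-1)^{σx}S¹_x`, `o^{(2)}_x = (-1)^{σx}S²_x`, `S_x = nbhd x`, `r = 2d+2`,
  `ō = s`) — every structure field PROVED; dictionary lemmas (`u1System_hamiltonian`, `u1System_field`, …) and
  hypothesis iv) (2.17) from matrix data (`u1System_isLROEigenstate`).
* §3 KT's normalisation of the order parameter: `Re ω_GS((O^{(1)})²) = Σ_{x,y}(-1)^{σx}(-1)^{σy}Re ω_GS(S¹_xS¹_y)`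
  (`re_groundStateFunctional_stagSpin_mul_stagSpin`; `σ = 0`: `= Σ_{x,y}hcGroundCorr 0`, the tree's ground-state
  correlation of `HardCoreBosonGroundStateBEC.lean`), the tree's LRO sequence of `γ_∞ = hardCoreGroundODLRO` on the
  torus of side `2(j+1)` equals `2 Re ω_GS((S¹_tot)²)/N²` (`lroSeq_succ_eq`), whence an eventual floor `c ≤ lroSeq`
  gives `(c/2)N² ≤ Re ω_GS((S¹_tot)²)` (`eventually_le_of_eventually_le_lroSeq`) and `HasEvenTorusLRO γ_∞` gives
  `∃ a > 0`, eventually `aN² ≤ Re ω_GS((S¹_tot)²)` (`exists_pos_eventually_le_of_hasEvenTorusLRO`).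
* §4 ENGINE **`ground_order_ge_sqrt_two_of_eventually_lro`** (Theorem 7.3 along any tori `Λ_k`, `N_k → ∞`, any `λ`, any
  sign exponents `σ_k`): an eventual floor `aN_k² ≤ Re ω_GS((O^{(1)}_k)²)`, `a > 0`, forces for every `B > 0`, `ε > 0`,
  eventually, EVERY unit ground state `Φ_B` of `H_k - B·O^{(1)}_k` to satisfy `N_k⁻¹Re Φ_B†O^{(1)}_kΦ_B ≥ √2·√a - ε`
  (proof as printed, by name: a long-range-ordered ground eigenstate in an `S³_tot`-sector —
  `Matrix.exists_groundState_eigenvector_re_ge` —, iv) by `u1System_isLROEigenstate`, then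
  `KomaTasaki.komaTasakiU1Field_u1` = the trial state (7.23) and the variational transfer (7.5)).
* §5 THE THEOREMS FOR THE MODEL (`O^{(1)} = S¹_tot`, the volume limit taken first at fixed `B > 0`, a fortiori (7.11)):
  - **`hardCoreLatticeGas_ground_spontaneousBEC`** — every `d ≥ 2`: `∃ λ₀ > 0 ∀ 0 ≤ λ < λ₀ ∃ σ > 0 ∀ B > 0 ∀ ε > 0`,
    eventually on the even tori `(ℤ/2(j+1)ℤ)^d`, EVERY normalised ground state `Φ_B` of `H - B·S¹_tot` has
    `N⁻¹Re⟨Φ_B, S¹_totΦ_B⟩ ≥ √2 σ - ε` (a nonvanishing condensate amplitude `N⁻¹⟨Σ_x(a_x + a†_x)/2⟩` under an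
    infinitesimal gauge-breaking field);
  - **`hardCoreLatticeGas_ground_spontaneousBEC_two`** — `d = 2`, `0 ≤ λ ≤ 1/40`, explicit: `≥ √(1/250) - ε`
    (`σ² = 1/500` from the tree's floor `lroSeq ≥ 1/250`; `√2σ = √(1/250) ≈ 0.063`);
  - tracial forms `…_groundStateFunctional` (the uniform mixture `ω_{GS,B}` of the ground states of `H - B·S¹_tot`,
    `XXZKT.le_re_groundStateFunctional_div_of_forall_groundState`) and zero-temperature-limit forms
    `…_zeroTemperature` (`lim_{β→∞}N⁻¹Re⟨S¹_tot⟩_{β,H-B·S¹_tot}` exists and obeys the same floor — the `β → ∞` limit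
    inside KT93 (1.9) taken before `Λ↑ℤ^d`);
  - the symmetric side for contrast: at `B = 0` the tracial ground state has `ω_GS(S¹_x) = 0` for every `x`, so
    `N⁻¹Re ω_GS(S¹_tot) = 0` on every torus (`hardCoreLatticeGas_ground_order_eq_zero`, the tree's half-turn symmetry
    `groundStateFunctional_siteSpin_zero_eq_zero`) — KT93's "obscured symmetry breaking" (Theorem 7.1 context).

WHAT THIS IS NOT: no statement at `T > 0` (for `d ≥ 3` see `XXZThermalSpontaneousOrder.lean`; in `d = 2` there is no
order at `T > 0`); no statement for large `λ` (the Mott phase, ALSSY Theorem 2, where there is no condensation); the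
`liminf_{B↓0}` of (7.11) is implicit in "for every `B > 0`"; nothing here is about the Hubbard model — it is a
transfer-model theorem (hard-core bosons = the `U = ∞` limit of the Bose–Hubbard model, ALSSY §1).  Context: for
continuum/Bose–Hubbard-type bosons Lieb–Seiringer–Yngvason prove `BEC ⟹ (BEC)_qa ⟺ GSB` by Bogoliubov's `c`-number
substitution [LiebSeiringerYngvason2007, §1 eq. (1)]; the present file is the Koma–Tasaki route for the spin-½ lattice gas.

## References
* [KomaTasaki1993] T. Koma, H. Tasaki, Commun. Math. Phys. **158** (1993) 191–214, §2 ii)–v), (2.6), (2.12), (2.14),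
  (2.17); §6 Remark p. 208; §7 (7.1), Theorem 7.3 (7.11), p. 211, proof pp. 212–213 ((7.23)–(7.24), (7.5)).
* [KomaTasaki1994] T. Koma, H. Tasaki, J. Stat. Phys. **76** (1994) 745–803, §2.3, Theorem 2.5 (2.30), §3.3.
* [AizenmanEtAl2004] M. Aizenman, E. H. Lieb, R. Seiringer, J. P. Solovej, J. Yngvason, Phys. Rev. A **70** (2004)
  023612, §1–§2, Theorem 1.
* [LSSY2005] E. H. Lieb, R. Seiringer, J. P. Solovej, J. Yngvason, *The Mathematics of the Bose Gas and its
  Condensation*, Birkhäuser 2005, Ch. 11 §11.1–§11.3.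
* [KLS1988PRL] T. Kennedy, E. H. Lieb, B. S. Shastry, Phys. Rev. Lett. **61** (1988) 2582–2584.
* [LiebSeiringerYngvason2007] E. H. Lieb, R. Seiringer, J. Yngvason, Rep. Math. Phys. **59** (2007) 389–399, §1 (1).
* [Tasaki2020] H. Tasaki, *Physics and Mathematics of Quantum Many-Body Systems*, Springer 2020, §2.1, App. A.2.
-/

noncomputable section

open Matrix Finset Filter Topology WithLp
open scoped ComplexOrder Matrix.Norms.L2Operator InnerProductSpace ComplexConjugate
open Literature.MathematicalPhysics.QuantumLattice Literature.MathematicalPhysics.QuantumLattice.SpinOperators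
  Literature.MathematicalPhysics.QuantumLattice.KomaTasaki Literature.Probability.LatticeModels
  Literature.Barriers.AtomisticToContinuum Literature.Barriers.AtomisticToContinuum.BoseGas

namespace Literature.MathematicalPhysics.QuantumLattice

namespace HardCoreKT

open XXZKT

variable {d : ℕ}

/-! ### §1. The local Hamiltonians of the hard-core lattice gas -/

section LocalHam

variable (d) (L : ℕ) [NeZero L] (lam : ℝ)

/-- The on-site part of `h_x`: the staggered field plus the constant, `λ(½·1 + (-1)^xS³_x)` = `λ(-1)^x n_x + const`
in boson language. [cite: AizenmanEtAl2004, §1 eq. (1) (the term `λΣ_x(-1)^x n_x`)] [cite: KomaTasaki1993, §2 ii)] -/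
def onSite (x : TorusSite d L) : Op (TorusSite d L) 2 :=
  (lam : ℂ) • ((1 / 2 : ℂ) • (1 : Op (TorusSite d L) 2) + ((-1 : ℂ) ^ (∑ i, (x i).val)) • siteSpin 1 x 2)

/-- **The local Hamiltonian `h_x`** of KT93 §2 ii) for the hard-core lattice gas: half of the hopping terms on the bonds
at `x` plus the on-site term, `h_x = -(½)Σ_{y∼x}(S¹_xS¹_y + S²_xS²_y) + λ(½ + (-1)^xS³_x)`.
[cite: KomaTasaki1993, §2 ii) (2.2)] [cite: AizenmanEtAl2004, §1 eq. (1), §2 (spin form)] -/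
def localHam (x : TorusSite d L) : Op (TorusSite d L) 2 :=
  XXZKT.localHam 1 (torusGraph d L) (-1) 0 x + onSite d L lam x

/-- **`Σ_x h_x = H`** (`= hardCoreLatticeGas d L λ = xyTorus d L 1 + λΣ_x(½ + (-1)^xS³_x)`).
[cite: KomaTasaki1993, §2 (2.2)] [cite: AizenmanEtAl2004, §2 (the Hamiltonian in spin language)] -/
theorem sum_localHam : ∑ x, localHam d L lam x = hardCoreLatticeGas d L lam := by
  simp only [localHam, onSite]
  rw [Finset.sum_add_distrib, XXZKT.sum_localHam, ← Finset.smul_sum]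
  exact (hardCoreLatticeGas_eq d L lam).symm

/-- The on-site term is Hermitian. [cite: KomaTasaki1993, §2 ii) (`h_x` self-adjoint)] -/
theorem isHermitian_onSite (x : TorusSite d L) : (onSite d L lam x).IsHermitian := by
  unfold onSite
  refine IsHermitian.smul (IsHermitian.add ?_ ?_) (by rw [isSelfAdjoint_iff, Complex.star_def, Complex.conj_ofReal])
  · exact isHermitian_one.smul (by rw [isSelfAdjoint_iff, Complex.star_def, map_div₀, map_one, map_ofNat])
  · exact (siteSpin_isHermitian 1 x 2).smul (by rw [isSelfAdjoint_iff, star_pow, Complex.star_def, map_neg, map_one])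

/-- `h_x` is Hermitian. [cite: KomaTasaki1993, §2 ii)] -/
theorem isHermitian_localHam (x : TorusSite d L) : (localHam d L lam x).IsHermitian :=
  (XXZKT.isHermitian_localHam 1 _ (-1) 0 x).add (isHermitian_onSite d L lam x)

/-- `‖λ(½·1 + (-1)^xS³_x)‖ ≤ |λ|(½ + s)`. [cite: KomaTasaki1993, §2 ii) (`‖h_x‖ ≤ h`)] -/
theorem norm_onSite_le (x : TorusSite d L) : ‖onSite d L lam x‖ ≤ |lam| * (1 / 2 + sNorm 1) := by
  unfold onSite
  rw [norm_smul, Complex.norm_real, Real.norm_eq_abs]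
  refine mul_le_mul_of_nonneg_left ((norm_add_le _ _).trans (add_le_add ?_ ?_)) (abs_nonneg _)
  · rw [norm_smul, CStarRing.norm_one, mul_one, norm_div, norm_one, Complex.norm_ofNat]
  · rw [norm_smul, norm_pow, norm_neg, norm_one, one_pow, one_mul]
    exact norm_siteSpin_le_sNorm 1 x 2

/-- The uniform local-Hamiltonian bound of the hard-core gas, `h̄ = hbar_XY + |λ|(½ + s)`
(`hbar_XY = XXZKT.hbar d 1 (-1) 0`). [cite: KomaTasaki1993, §2 ii)] -/
def hbar : ℝ := XXZKT.hbar d 1 (-1) 0 + |lam| * (1 / 2 + sNorm 1)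

/-- **`‖h_x‖ ≤ h̄`**. [cite: KomaTasaki1993, §2 ii)] -/
theorem norm_localHam_le (x : TorusSite d L) : ‖localHam d L lam x‖ ≤ hbar d lam :=
  (norm_add_le _ _).trans (add_le_add (XXZKT.norm_localHam_le d L 1 (-1) 0 x) (norm_onSite_le d L lam x))

/-- The on-site term at `x` commutes with every spin component at `y ≠ x`. [cite: KomaTasaki1993, §2 ii)] -/
theorem commute_onSite_smul_siteSpin {x y : TorusSite d L} (hyx : y ≠ x) (c : ℂ) (β : Fin 3) :
    Commute (onSite d L lam x) (c • siteSpin 1 y β) := by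
  unfold onSite
  refine (Commute.add_left ((Commute.one_left _).smul_left _) ?_).smul_left _
  exact ((siteSpin_commute_of_ne_holds 1 hyx.symm 2 β).smul_left _).smul_right _

/-- **Locality ii)**: `[h_x, o^{(α)}_y] = 0` for `y ∉ S_x = nbhd x` (`o^{(α)}_y = (-1)^{σy}S^α_y`).
[cite: KomaTasaki1993, §2 ii)] -/
theorem commute_localHam_ktDensity (σ : TorusSite d L → ℕ) {x y : TorusSite d L} (hy : y ∉ nbhd d L x)
    (α : Fin 2) : Commute (localHam d L lam x) (ktDensity 1 σ α y) := by
  obtain ⟨hne, hadj⟩ := ne_and_not_adj_of_not_mem_nbhd d L hy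
  unfold localHam ktDensity
  exact (commute_localHam_stagSign_smul_siteSpin 1 σ (torusGraph d L) (-1) 0 hne hadj _).add_left
    (commute_onSite_smul_siteSpin d L lam hne _ _)

end LocalHam

/-! ### §2. The hard-core lattice gas as a Koma–Tasaki `U(1)` system -/

section System

variable (d) (L : ℕ) [NeZero L] (lam : ℝ)

/-- **THE HARD-CORE LATTICE GAS IN A STAGGERED FIELD AS A KOMA–TASAKI `U(1)` SYSTEM** (ground-state setting,
KT93 §7 / KT94 §2.3, §3.3).  Lattice `Λ = (ℤ/Lℤ)^d`, Hilbert space `ℓ²(Λ → Fin 2)`, `h_x = localHam d L λ x`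
(`Σ_x h_x = hardCoreLatticeGas d L λ`), `o^{(1)}_x = (-1)^{σx}Sˣ_x`, `o^{(2)}_x = (-1)^{σx}Sʸ_x`, `C_Λ = Sᶻ_tot`
(particle number minus `|Λ|/2`), `S_x = nbhd x`, `r = 2d+2`, `h̄ = hbar d λ`, `ō = sNorm 1`; hypotheses (2.12)
`[H, C] = 0`, (2.14), i) `[o_x, o_y] = 0` (`x ≠ y`), ii) locality, `|S_x| ≤ r`, iii) norms — all proved.  `σ = 0`:
the condensate order operator `O^{(1)} = Sˣ_tot`.
[cite: KomaTasaki1993, §2 ii)–v), (2.12), (2.14); §7 p. 211] [cite: KomaTasaki1994, §2.3 (2.12)–(2.16), §3.3] -/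
def u1System (σ : TorusSite d L → ℕ) :
    KomaTasaki.U1System (TorusSite d L) (SpinSpace (TorusSite d L) 2) where
  h x := toEuclideanCLM (n := TensorIndex (TorusSite d L) 2) (𝕜 := ℂ) (localHam d L lam x)
  o α x := toEuclideanCLM (n := TensorIndex (TorusSite d L) 2) (𝕜 := ℂ) (ktDensity 1 σ α x)
  C := toEuclideanCLM (n := TensorIndex (TorusSite d L) 2) (𝕜 := ℂ) (totalSpin 1 2)
  supp := nbhd d L
  r := 2 * d + 2
  hbar := hbar d lam
  obar := sNorm 1
  isSymmetric_h x := isSymmetric_toEuclideanCLM_of_isHermitian (isHermitian_localHam d L lam x)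
  isSymmetric_o α x := isSymmetric_toEuclideanCLM_of_isHermitian (isHermitian_ktDensity 1 σ α x)
  isSymmetric_C := isSymmetric_toEuclideanCLM_of_isHermitian (totalSpin_isHermitian 1 2)
  commute_hamiltonian_C := by
    rw [← map_sum, sum_localHam]
    exact commute_toEuclideanCLM_of_commute (HardCoreBoson.commute_hardCoreLatticeGas_totalSpin lam)
  order_zero_C := by
    rw [← map_sum, ← map_sum, ← map_mul, ← map_mul, ← map_sub, sum_ktDensity_zero, sum_ktDensity_one,
      stagSpin_zero_comm_totalSpin_two, map_neg, map_smul]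
  order_one_C := by
    rw [← map_sum, ← map_sum, ← map_mul, ← map_mul, ← map_sub, sum_ktDensity_zero, sum_ktDensity_one,
      stagSpin_one_comm_totalSpin_two, map_smul]
  commute_o x y hxy α β := commute_toEuclideanCLM_of_commute (commute_stagSign_smul_siteSpin 1 σ hxy _ _)
  commute_h_o x y hy α := commute_toEuclideanCLM_of_commute (commute_localHam_ktDensity d L lam σ hy α)
  card_supp_le x := (XXZKT.card_nbhd_le d L x).trans (by omega)
  two_le_r := by omega
  norm_h_le x := by rw [Matrix.l2_opNorm_toEuclideanCLM]; exact norm_localHam_le d L lam x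
  norm_o_le α x := by rw [Matrix.l2_opNorm_toEuclideanCLM]; exact norm_ktDensity_le 1 σ α x
  obar_pos := lt_of_lt_of_le zero_lt_one (one_le_sNorm 1)

/-! #### Dictionary -/

variable (σ : TorusSite d L → ℕ)

/-- `H_sys = toEuclideanCLM (hardCoreLatticeGas d L λ)`. [cite: KomaTasaki1994, (2.3), §3.3] -/
theorem u1System_hamiltonian :
    (u1System d L lam σ).hamiltonian =
      toEuclideanCLM (n := TensorIndex (TorusSite d L) 2) (𝕜 := ℂ) (hardCoreLatticeGas d L lam) := by
  change ∑ x, toEuclideanCLM (n := TensorIndex (TorusSite d L) 2) (𝕜 := ℂ) (localHam d L lam x) = _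
  rw [← map_sum, sum_localHam]

/-- `O^{(1)}_sys = toEuclideanCLM (Σ_x(-1)^{σx}Sˣ_x)`. [cite: KomaTasaki1994, (2.13)] [cite: KomaTasaki1993, §2 (2.14)] -/
theorem u1System_order_zero :
    (u1System d L lam σ).order 0 =
      toEuclideanCLM (n := TensorIndex (TorusSite d L) 2) (𝕜 := ℂ) (stagSpin 1 σ 0) := by
  change ∑ x, toEuclideanCLM (n := TensorIndex (TorusSite d L) 2) (𝕜 := ℂ) (ktDensity 1 σ 0 x) = _
  rw [← map_sum, sum_ktDensity_zero]

/-- `O^{(2)}_sys = toEuclideanCLM (Σ_x(-1)^{σx}Sʸ_x)`. [cite: KomaTasaki1994, (2.13)] -/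
theorem u1System_order_one :
    (u1System d L lam σ).order 1 =
      toEuclideanCLM (n := TensorIndex (TorusSite d L) 2) (𝕜 := ℂ) (stagSpin 1 σ 1) := by
  change ∑ x, toEuclideanCLM (n := TensorIndex (TorusSite d L) 2) (𝕜 := ℂ) (ktDensity 1 σ 1 x) = _
  rw [← map_sum, sum_ktDensity_one]

/-- `C_sys = toEuclideanCLM (Sᶻ_tot)`. [cite: KomaTasaki1994, (2.12)] -/
theorem u1System_C :
    (u1System d L lam σ).C = toEuclideanCLM (n := TensorIndex (TorusSite d L) 2) (𝕜 := ℂ) (totalSpin 1 2) :=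
  rfl

/-- `ō = sNorm 1`. [cite: KomaTasaki1994, §2.3 iii)] -/
theorem u1System_obar : (u1System d L lam σ).obar = sNorm 1 := rfl

/-- `h̄ = hbar d λ`. [cite: KomaTasaki1994, §2.3 iii)] -/
theorem u1System_hbar : (u1System d L lam σ).hbar = hbar d lam := rfl

/-- `r = 2d+2`. [cite: KomaTasaki1994, §2.3 ii)] -/
theorem u1System_r : (u1System d L lam σ).r = 2 * d + 2 := rfl

/-- **The sourced Hamiltonian of the instance is KT93's `H_Λ(B) = H_Λ - BO^{(1)}_Λ` (2.6)**:
`H_sys - B·O^{(1)}_sys = toEuclideanCLM (hardCoreLatticeGas d L λ - B·Σ_x(-1)^{σx}Sˣ_x)`.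
[cite: KomaTasaki1993, §2 (2.6), §7] -/
theorem u1System_field (B : ℝ) :
    (u1System d L lam σ).hamiltonian - (B : ℂ) • (u1System d L lam σ).order 0 =
      toEuclideanCLM (n := TensorIndex (TorusSite d L) 2) (𝕜 := ℂ)
        (hardCoreLatticeGas d L lam - (B : ℂ) • stagSpin 1 σ 0) := by
  rw [u1System_hamiltonian, u1System_order_zero, ← map_smul, ← map_sub]

/-- **Hypothesis iv) (2.17) from matrix data.**  A unit vector `Φ` of `ℓ²(Λ → Fin 2)` which is an eigenvector of
`H = hardCoreLatticeGas d L λ` (eigenvalue `E₀`) and of `Sᶻ_tot` (`Sᶻ_totΦ = νΦ`), with long-range order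
`(μ ō N)² ≤ Re Φ†(O^{(1)})²Φ`, `0 < μ`, is an `IsLROEigenstate` of `u1System` with parameter `μ`
(`⟨(O^{(1)})²⟩ = ⟨(O^{(2)})²⟩` by `inner_order_sq_eq_of_eigen_C`, `μ ≤ 1` by `mu_le_one_of_lro`).
[cite: KomaTasaki1994, §2.3 iv) (2.17)] [cite: KomaTasaki1993, §7 (7.1), i')] -/
theorem u1System_isLROEigenstate {Φ : TensorIndex (TorusSite d L) 2 → ℂ} {E₀ : ℝ} {ν : ℂ} {μ : ℝ}
    (hΦ : star Φ ⬝ᵥ Φ = 1)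
    (hH : hardCoreLatticeGas d L lam *ᵥ Φ = (E₀ : ℂ) • Φ)
    (hN : totalSpin 1 2 *ᵥ Φ = ν • Φ) (hμ : 0 < μ)
    (hlro : (μ * sNorm 1 * (Fintype.card (TorusSite d L) : ℝ)) ^ 2 ≤
      (star Φ ⬝ᵥ (stagSpin 1 σ 0 *ᵥ (stagSpin 1 σ 0 *ᵥ Φ))).re) :
    KomaTasaki.IsLROEigenstate (u1System d L lam σ) (toLp 2 Φ) E₀ μ := by
  set sys := u1System d L lam σ with hsys
  have hC : sys.C (toLp 2 Φ) = ν • toLp 2 Φ := by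
    rw [hsys, u1System_C, toEuclideanCLM_toLp, hN, toLp_smul]
  have hsq := KomaTasaki.U1System.inner_order_sq_eq_of_eigen_C sys hC
  have h0 : (⟪(toLp 2 Φ : SpinSpace (TorusSite d L) 2), sys.order 0 (sys.order 0 (toLp 2 Φ))⟫_ℂ).re =
      (star Φ ⬝ᵥ (stagSpin 1 σ 0 *ᵥ (stagSpin 1 σ 0 *ᵥ Φ))).re := by
    rw [hsys, u1System_order_zero, toEuclideanCLM_toLp, toEuclideanCLM_toLp, inner_toLp_toLp_eq_dotProduct]
  have hnorm : ‖(toLp 2 Φ : SpinSpace (TorusSite d L) 2)‖ = 1 := norm_toLp_eq_one_of_dotProduct hΦ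
  have hlro' : (μ * sys.obar * Fintype.card (TorusSite d L)) ^ 2 ≤
      (⟪(toLp 2 Φ : SpinSpace (TorusSite d L) 2), sys.order 0 (sys.order 0 (toLp 2 Φ))⟫_ℂ).re := by
    rw [h0, hsys, u1System_obar]
    exact hlro
  exact
    { norm_eq_one := hnorm
      eigen_hamiltonian := by rw [hsys, u1System_hamiltonian, toEuclideanCLM_toLp, hH, toLp_smul]
      eigen_C := ⟨_, hC⟩
      mu_pos := hμ
      mu_le_one := KomaTasaki.U1System.mu_le_one_of_lro sys hnorm hlro'
      lro := hlro'
      lro_eq := hsq }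

end System

/-! ### §3. The ground-state order parameter in Koma–Tasaki's normalisation -/

section GroundLRO

/-- **KT93 (7.1) for the tracial ground state of the hard-core gas = a double sum of the tree's ground-state
correlations**: `Re ω_GS((O^{(1)})²) = Σ_{x,y}(-1)^{σx}(-1)^{σy}Re ω_GS(Sˣ_xSˣ_y)`,
`ω_GS = groundStateFunctional (hardCoreLatticeGas d L λ)`, `Re ω_GS(Sˣ_xSˣ_y) = hcGroundCorr 0 L λ x y`.
[cite: KomaTasaki1993, §7 (7.1)] [cite: AizenmanEtAl2004, §2] -/
theorem re_groundStateFunctional_stagSpin_mul_stagSpin (L : ℕ) [NeZero L] (lam : ℝ) (σ : TorusSite d L → ℕ) :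
    ((hardCoreLatticeGas d L lam).groundStateFunctional (stagSpin 1 σ 0 * stagSpin 1 σ 0)).re =
      ∑ x : TorusSite d L, ∑ y : TorusSite d L, stagSign σ x * stagSign σ y * hcGroundCorr 0 L lam x y := by
  rw [stagSpin, Finset.sum_mul_sum, map_sum, Complex.re_sum]
  refine Finset.sum_congr rfl fun x _ => ?_
  rw [map_sum, Complex.re_sum]
  refine Finset.sum_congr rfl fun y _ => ?_
  rw [Matrix.smul_mul, Matrix.mul_smul, smul_smul, LinearMap.map_smul, smul_eq_mul, ← Complex.ofReal_mul,
    Complex.re_ofReal_mul, hcGroundCorr_of_neZero]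

/-- `Re ω_GS((O^{(1)})²) ≥ 0`. [cite: KomaTasaki1993, §7 (7.1)] -/
theorem re_groundStateFunctional_stagSpin_mul_stagSpin_nonneg (L : ℕ) [NeZero L] (lam : ℝ)
    (σ : TorusSite d L → ℕ) :
    0 ≤ ((hardCoreLatticeGas d L lam).groundStateFunctional (stagSpin 1 σ 0 * stagSpin 1 σ 0)).re :=
  re_groundStateFunctional_mul_self_nonneg _ (isHermitian_stagSpin 1 σ 0)

/-- The plain case `σ = 0` (`O^{(1)} = Sˣ_tot`): `Re ω_GS((Sˣ_tot)²) = Σ_{x,y}hcGroundCorr 0 L λ x y`, the double sum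
whose `|Λ|⁻²`-density is half the tree's LRO sequence of `γ_∞`. [cite: KomaTasaki1993, §7 (7.1)]
[cite: AizenmanEtAl2004, §2, Theorem 1] -/
theorem re_groundStateFunctional_stagSpin_zero_mul (L : ℕ) [NeZero L] (lam : ℝ) :
    ((hardCoreLatticeGas d L lam).groundStateFunctional
        (stagSpin 1 (fun _ : TorusSite d L => 0) 0 * stagSpin 1 (fun _ : TorusSite d L => 0) 0)).re =
      ∑ x : TorusSite d L, ∑ y : TorusSite d L, hcGroundCorr 0 L lam x y := by
  rw [re_groundStateFunctional_stagSpin_mul_stagSpin]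
  refine Finset.sum_congr rfl fun x _ => Finset.sum_congr rfl fun y _ => ?_
  rw [stagSign, stagSign, pow_zero, one_mul, one_mul]

/-- The same with `Sˣ_tot` spelled `totalSpin 1 0`. [cite: KomaTasaki1993, §7 (7.1)] -/
theorem re_groundStateFunctional_totalSpin_mul_totalSpin (L : ℕ) [NeZero L] (lam : ℝ) :
    ((hardCoreLatticeGas d L lam).groundStateFunctional (totalSpin 1 0 * totalSpin 1 0)).re =
      ∑ x : TorusSite d L, ∑ y : TorusSite d L, hcGroundCorr 0 L lam x y := by
  rw [← stagSpin_zero_eq_totalSpin 1 0, re_groundStateFunctional_stagSpin_zero_mul]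

/-- **The tree's LRO sequence of `γ_∞ = hardCoreGroundODLRO` on the torus of side `2(j+1)` in KT's normalisation**:
`|Λ|⁻²Σ_{x,y}γ_∞(x,y) = 2 Re ω_GS((Sˣ_tot)²)/N²`. [cite: AizenmanEtAl2004, §2] [cite: KomaTasaki1993, §7 (7.1)] -/
theorem lroSeq_succ_eq (lam : ℝ) (j : ℕ) :
    (∑ x ∈ halfOpenBox d (2 * (j + 1)), ∑ y ∈ halfOpenBox d (2 * (j + 1)),
        torusPullback (fun L x y => hardCoreGroundODLRO (d := d) L lam x y) (2 * (j + 1)) x y) /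
        ((halfOpenBox d (2 * (j + 1))).card : ℝ) ^ 2 =
      2 * (((hardCoreLatticeGas d (2 * (j + 1)) lam).groundStateFunctional
          (stagSpin 1 (fun _ : TorusSite d (2 * (j + 1)) => 0) 0 *
            stagSpin 1 (fun _ : TorusSite d (2 * (j + 1)) => 0) 0)).re /
        (Fintype.card (TorusSite d (2 * (j + 1))) : ℝ) ^ 2) := by
  rw [hardCoreGround_lroSeq_eq lam (j + 1), re_groundStateFunctional_stagSpin_zero_mul, card_torusSite,
    Nat.cast_pow]

/-- **An eventual floor of the LRO sequence in KT's form**: if eventually `c ≤ |Λ|⁻²Σ_{x,y}γ_∞` along the even tori,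
then eventually `(c/2)N² ≤ Re ω_GS((Sˣ_tot)²)` on `(ℤ/2(j+1)ℤ)^d`. [cite: KomaTasaki1993, §7 (7.1)]
[cite: AizenmanEtAl2004, §2] -/
theorem eventually_le_of_eventually_le_lroSeq {lam c : ℝ}
    (h : ∀ᶠ j : ℕ in atTop, c ≤
      (∑ x ∈ halfOpenBox d (2 * (j + 1)), ∑ y ∈ halfOpenBox d (2 * (j + 1)),
          torusPullback (fun L x y => hardCoreGroundODLRO (d := d) L lam x y) (2 * (j + 1)) x y) /
        ((halfOpenBox d (2 * (j + 1))).card : ℝ) ^ 2) :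
    ∀ᶠ j : ℕ in atTop, c / 2 * (Fintype.card (TorusSite d (2 * (j + 1))) : ℝ) ^ 2 ≤
      ((hardCoreLatticeGas d (2 * (j + 1)) lam).groundStateFunctional
        (stagSpin 1 (fun _ : TorusSite d (2 * (j + 1)) => 0) 0 *
          stagSpin 1 (fun _ : TorusSite d (2 * (j + 1)) => 0) 0)).re := by
  filter_upwards [h] with j hj
  have hN : (0 : ℝ) < (Fintype.card (TorusSite d (2 * (j + 1))) : ℝ) ^ 2 := by
    have : (0 : ℝ) < Fintype.card (TorusSite d (2 * (j + 1))) := Nat.cast_pos.mpr Fintype.card_pos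
    positivity
  rw [lroSeq_succ_eq, ← mul_div_assoc, le_div_iff₀ hN] at hj
  linarith

/-- **Ground-state BEC (tree `HasEvenTorusLRO` of `γ_∞`) in KT's form**: there is `a > 0` with
`aN² ≤ Re ω_GS((Sˣ_tot)²)` on all large even tori `(ℤ/2(j+1)ℤ)^d` — so `σ = √a > 0` is an eventual lower bound for
KT93's `σ_Λ = N⁻¹√(Φ_Λ,(O_Λ)²Φ_Λ)` of (7.1) for the tracial ground state. [cite: KomaTasaki1993, §7 (7.1)]
[cite: AizenmanEtAl2004, §2, Theorem 1] -/
theorem exists_pos_eventually_le_of_hasEvenTorusLRO {lam : ℝ}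
    (h : HasEvenTorusLRO (fun L x y => hardCoreGroundODLRO (d := d) L lam x y)) :
    ∃ a : ℝ, 0 < a ∧ ∀ᶠ j : ℕ in atTop,
      a * (Fintype.card (TorusSite d (2 * (j + 1))) : ℝ) ^ 2 ≤
        ((hardCoreLatticeGas d (2 * (j + 1)) lam).groundStateFunctional
          (stagSpin 1 (fun _ : TorusSite d (2 * (j + 1)) => 0) 0 *
            stagSpin 1 (fun _ : TorusSite d (2 * (j + 1)) => 0) 0)).re := by
  rw [hasEvenTorusLRO_iff] at h
  obtain ⟨f, hf, hpos⟩ : ∃ f : ℕ → ℝ, (∀ k, f k =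
      (∑ x ∈ halfOpenBox d (2 * k), ∑ y ∈ halfOpenBox d (2 * k),
        torusPullback (fun L x y => hardCoreGroundODLRO (d := d) L lam x y) (2 * k) x y) /
          ((halfOpenBox d (2 * k)).card : ℝ) ^ 2) ∧ 0 < liminf f atTop := ⟨_, fun _ => rfl, h⟩
  have hnonneg : ∀ j : ℕ, 0 ≤ f (j + 1) := fun j => by
    rw [hf, lroSeq_succ_eq]
    exact mul_nonneg zero_le_two
      (div_nonneg (re_groundStateFunctional_stagSpin_mul_stagSpin_nonneg _ lam _) (by positivity))
  have hlim : 0 < liminf (fun j : ℕ => f (j + 1)) atTop := by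
    rw [Filter.liminf_nat_add f 1]
    exact hpos
  have hcl : liminf (fun j : ℕ => f (j + 1)) atTop / 2 < liminf (fun j : ℕ => f (j + 1)) atTop :=
    half_lt_self hlim
  have hev := eventually_lt_of_lt_liminf hcl (isBoundedUnder_of ⟨0, fun j => hnonneg j⟩)
  refine ⟨liminf (fun j : ℕ => f (j + 1)) atTop / 2 / 2, by positivity, ?_⟩
  refine eventually_le_of_eventually_le_lroSeq (hev.mono fun j hj => ?_)
  rw [← hf]
  exact hj.le

end GroundLRO

/-! ### §4. The engine: ground-state condensation ⟹ condensate amplitude under the gauge-breaking field -/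

section Engine

/-- **KT93 THEOREM 7.3 FOR THE HARD-CORE LATTICE GAS (engine, `U(1)`, factor `√2`).**  Along any sequence of tori
`Λ_k = (ℤ/L_kℤ)^d` with `N_k = |Λ_k| → ∞`, sign exponents `σ_k`, any `λ`, and `H_k = hardCoreLatticeGas d L_k λ`: if the
tracial ground states have the eventual long-range-order floor `aN_k² ≤ Re ω_GS((O^{(1)}_k)²)`,
`O^{(1)}_k = Σ_x(-1)^{σ_k x}Sˣ_x`, `a > 0`, then for every field `B > 0` and every `ε > 0`, eventually in `k`, EVERY
unit ground state `Φ_B` of `H_k - B·O^{(1)}_k` satisfies `N_k⁻¹Re Φ_B†O^{(1)}_kΦ_B ≥ √2·√a - ε` — i.e.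
`liminf_k N_k⁻¹(Φ_k(B), O^{(1)}Φ_k(B)) ≥ √2σ`, `σ = √a`, for every `B > 0`, a fortiori (7.11).  Proof as printed, by
name: a long-range-ordered ground eigenstate in an `Sᶻ_tot`-sector (`Matrix.exists_groundState_eigenvector_re_ge`),
hypothesis iv) (`u1System_isLROEigenstate`), then `KomaTasaki.komaTasakiU1Field_u1` (the symmetry-breaking trial
state (7.23) and the variational transfer (7.5)).
[cite: KomaTasaki1993, Theorem 7.3 (7.11), p. 211, (7.5), (7.23)–(7.24)] [cite: KomaTasaki1994, Theorem 2.5 (2.30)] -/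
theorem ground_order_ge_sqrt_two_of_eventually_lro {lam a : ℝ} (Lk : ℕ → ℕ) [∀ k, NeZero (Lk k)]
    (σ : ∀ k, TorusSite d (Lk k) → ℕ) (ha : 0 < a)
    (hN : Tendsto (fun k => Fintype.card (TorusSite d (Lk k))) atTop atTop)
    (hlro : ∀ᶠ k : ℕ in atTop, a * (Fintype.card (TorusSite d (Lk k)) : ℝ) ^ 2 ≤
      ((hardCoreLatticeGas d (Lk k) lam).groundStateFunctional
        (stagSpin 1 (σ k) 0 * stagSpin 1 (σ k) 0)).re)
    {B ε : ℝ} (hB : 0 < B) (hε : 0 < ε) :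
    ∀ᶠ k : ℕ in atTop, ∀ ΦB : TensorIndex (TorusSite d (Lk k)) 2 → ℂ, star ΦB ⬝ᵥ ΦB = 1 →
      (hardCoreLatticeGas d (Lk k) lam - (B : ℂ) • stagSpin 1 (σ k) 0) *ᵥ ΦB =
        ((hardCoreLatticeGas d (Lk k) lam - (B : ℂ) • stagSpin 1 (σ k) 0).groundEnergy : ℂ) • ΦB →
      Real.sqrt 2 * Real.sqrt a - ε ≤
        (star ΦB ⬝ᵥ (stagSpin 1 (σ k) 0 *ᵥ ΦB)).re / (Fintype.card (TorusSite d (Lk k)) : ℝ) := by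
  set μ : ℝ := Real.sqrt a / sNorm 1 with hμ_def
  have hs : 0 < sNorm 1 := lt_of_lt_of_le zero_lt_one (one_le_sNorm 1)
  have hμ : 0 < μ := div_pos (Real.sqrt_pos.2 ha) hs
  have hμs : Real.sqrt 2 * μ * sNorm 1 = Real.sqrt 2 * Real.sqrt a := by
    rw [hμ_def, mul_assoc, div_mul_cancel₀ _ hs.ne']
  obtain ⟨N₀, hN₀⟩ := KomaTasaki.komaTasakiU1Field_u1.{0, 0} μ (sNorm 1) (hbar d lam) (2 * d + 2) hB hε
  filter_upwards [hlro, Filter.tendsto_atTop.mp hN N₀] with k hk hNk ΦB hΦB hHB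
  -- the long-range-ordered ground eigenstate in an `Sᶻ_tot`-sector, and hypothesis iv)
  set H₀ := hardCoreLatticeGas d (Lk k) lam with hH₀
  have hH₀herm : H₀.IsHermitian := hardCoreLatticeGas_isHermitian d (Lk k) lam
  obtain ⟨Φ, hΦ, hHΦ, ⟨ν, hNΦ⟩, hlroΦ⟩ := Matrix.exists_groundState_eigenvector_re_ge hH₀herm
    (totalSpin_isHermitian 1 2) (HardCoreBoson.commute_hardCoreLatticeGas_totalSpin lam).eq
    (stagSpin 1 (σ k) 0 * stagSpin 1 (σ k) 0)
  have hlro' : (μ * sNorm 1 * (Fintype.card (TorusSite d (Lk k)) : ℝ)) ^ 2 ≤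
      (star Φ ⬝ᵥ (stagSpin 1 (σ k) 0 *ᵥ (stagSpin 1 (σ k) 0 *ᵥ Φ))).re := by
    rw [hμ_def, div_mul_cancel₀ _ hs.ne', mul_pow, Real.sq_sqrt ha.le, Matrix.mulVec_mulVec]
    exact hk.trans hlroΦ
  set sys := u1System d (Lk k) lam (σ k) with hsys
  have hLRO : KomaTasaki.IsLROEigenstate sys (toLp 2 Φ) H₀.groundEnergy μ :=
    u1System_isLROEigenstate d (Lk k) lam (σ k) hΦ hHΦ hNΦ hμ hlro'
  -- the ground-state hypotheses
  have hground : ∀ ψ : SpinSpace (TorusSite d (Lk k)) 2, ‖ψ‖ = 1 →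
      H₀.groundEnergy ≤ (⟪ψ, sys.hamiltonian ψ⟫_ℂ).re := by
    intro ψ hψ
    rw [hsys, u1System_hamiltonian]
    exact Matrix.groundEnergy_le_re_inner_toEuclideanCLM' hH₀herm ψ hψ
  set HB := H₀ - (B : ℂ) • stagSpin 1 (σ k) 0 with hHB_def
  have hHBherm : HB.IsHermitian :=
    hH₀herm.sub ((isHermitian_stagSpin 1 (σ k) 0).smul (by rw [isSelfAdjoint_iff, Complex.star_def, Complex.conj_ofReal]))
  have hfield : sys.hamiltonian - (B : ℂ) • sys.order 0 =
      toEuclideanCLM (n := TensorIndex (TorusSite d (Lk k)) 2) (𝕜 := ℂ) HB := by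
    rw [hsys, u1System_field]
  have hmin : ∀ ψ : SpinSpace (TorusSite d (Lk k)) 2, ‖ψ‖ = 1 →
      (⟪(toLp 2 ΦB : SpinSpace (TorusSite d (Lk k)) 2),
          (sys.hamiltonian - (B : ℂ) • sys.order 0) (toLp 2 ΦB)⟫_ℂ).re ≤
        (⟪ψ, (sys.hamiltonian - (B : ℂ) • sys.order 0) ψ⟫_ℂ).re := by
    intro ψ hψ
    rw [hfield]
    exact Matrix.re_inner_toEuclideanCLM_le_of_groundState hHBherm hΦB hHB ψ hψ
  -- KT93 Theorem 7.3
  have h := hN₀ sys (toLp 2 Φ) H₀.groundEnergy hLRO rfl le_rfl le_rfl hground hNk (toLp 2 ΦB)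
    (norm_toLp_eq_one_of_dotProduct hΦB) hmin
  rw [hμs, hsys, u1System_order_zero, toEuclideanCLM_toLp, inner_toLp_toLp_eq_dotProduct] at h
  exact h

end Engine

/-! ### §5. The theorems for the model -/

section Models

/-- **GROUND-STATE BOSE–EINSTEIN CONDENSATION OF THE HARD-CORE LATTICE GAS BREAKS THE `U(1)` GAUGE SYMMETRY
SPONTANEOUSLY, every `d ≥ 2` (KT93 Theorem 7.3 for ALSSY's model).**  For every `d ≥ 2` there is `λ₀ > 0` (the tree's
BEC window `hardCoreLatticeGas_groundState_bec`) such that for every staggered field `0 ≤ λ < λ₀` there is `σ > 0` — a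
long-range order of the symmetric ground states, `σ²N² ≤ (Φ_Λ,(Sˣ_tot)²Φ_Λ)` eventually — such that for every
gauge-breaking field `B > 0` and every `ε > 0`, eventually on the even tori `Λ = (ℤ/2(j+1)ℤ)^d`, EVERY normalised ground
state `Φ_B` of `H - B·Sˣ_tot`, `H = hardCoreLatticeGas d (2(j+1)) λ = -Σ_{⟨x,y⟩}(SˣSˣ+SʸSʸ) + λΣ_x(½ + (-1)^xSᶻ_x)`,
`Sˣ_tot = ½Σ_x(a_x + a†_x)`, satisfies **`N⁻¹Re⟨Φ_B, Sˣ_totΦ_B⟩ ≥ √2 σ - ε`**; i.e.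
`liminf_Λ N⁻¹(Φ_Λ(B), O^{(1)}_ΛΦ_Λ(B)) ≥ √2σ` for every `B > 0`, hence (7.11).  Covers `d = 2`.
[cite: KomaTasaki1993, Theorem 7.3 (7.11), p. 211] [cite: AizenmanEtAl2004, §2 ("For d = 2 this is true only in the
ground state"), Theorem 1] [cite: KLS1988PRL, Theorem] -/
theorem hardCoreLatticeGas_ground_spontaneousBEC (hd : 2 ≤ d) :
    ∃ lam₀ : ℝ, 0 < lam₀ ∧ ∀ lam : ℝ, 0 ≤ lam → lam < lam₀ →
      ∃ σ : ℝ, 0 < σ ∧ ∀ B : ℝ, 0 < B → ∀ ε : ℝ, 0 < ε → ∀ᶠ j : ℕ in atTop,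
        ∀ ΦB : TensorIndex (TorusSite d (2 * (j + 1))) 2 → ℂ, star ΦB ⬝ᵥ ΦB = 1 →
          (hardCoreLatticeGas d (2 * (j + 1)) lam - (B : ℂ) • totalSpin 1 0) *ᵥ ΦB =
            ((hardCoreLatticeGas d (2 * (j + 1)) lam - (B : ℂ) • totalSpin 1 0).groundEnergy : ℂ) • ΦB →
          Real.sqrt 2 * σ - ε ≤
            (star ΦB ⬝ᵥ (totalSpin 1 0 *ᵥ ΦB)).re / (Fintype.card (TorusSite d (2 * (j + 1))) : ℝ) := by
  obtain ⟨lam₀, hlam₀, hbec⟩ := hardCoreLatticeGas_groundState_bec hd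
  refine ⟨lam₀, hlam₀, fun lam hlam hlamlt => ?_⟩
  obtain ⟨a, ha, hlro⟩ := exists_pos_eventually_le_of_hasEvenTorusLRO (hbec lam hlam hlamlt)
  refine ⟨Real.sqrt a, Real.sqrt_pos.2 ha, fun B hB ε hε => ?_⟩
  have h := ground_order_ge_sqrt_two_of_eventually_lro (lam := lam) (fun j => 2 * (j + 1))
    (fun j => fun _ : TorusSite d (2 * (j + 1)) => 0) ha (tendsto_card_torusSite_two_mul_succ (by omega)) hlro hB hε
  simp only [stagSpin_zero_eq_totalSpin] at h
  exact h

/-- `√2·√(1/500) = √(1/250)`. [folklore] -/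
private theorem sqrt_two_mul_sqrt : Real.sqrt 2 * Real.sqrt (1 / 500) = Real.sqrt (1 / 250) := by
  rw [← Real.sqrt_mul zero_le_two]
  norm_num

/-- **The hard-core lattice gas on `ℤ²`, `0 ≤ λ ≤ 1/40`, with explicit constants**: for every `B > 0`, `ε > 0`,
eventually on the even tori `(ℤ/2(j+1)ℤ)²`, EVERY normalised ground state `Φ_B` of `H - B·Sˣ_tot` has
**`N⁻¹Re⟨Φ_B, Sˣ_totΦ_B⟩ ≥ √(1/250) - ε`** (`= √2σ - ε` with `σ² = 1/500`, the tree's two-dimensional ground-state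
floor `|Λ|⁻²Σ_{x,y}γ_∞ ≥ 1/250`, `hardCoreLatticeGas_groundState_lroSeq_ge_two`).  Two-dimensional ground-state BEC
with spontaneous gauge-symmetry breaking, where at `T > 0` there is none.
[cite: KomaTasaki1993, Theorem 7.3 (7.11), p. 211] [cite: AizenmanEtAl2004, §2 ("For d = 2 this is true only in the
ground state")] [cite: KLS1988PRL, eqs. (5)–(8)] -/
theorem hardCoreLatticeGas_ground_spontaneousBEC_two {lam : ℝ} (hlam : 0 ≤ lam) (hlam' : lam ≤ 1 / 40)
    {B ε : ℝ} (hB : 0 < B) (hε : 0 < ε) :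
    ∀ᶠ j : ℕ in atTop, ∀ ΦB : TensorIndex (TorusSite 2 (2 * (j + 1))) 2 → ℂ, star ΦB ⬝ᵥ ΦB = 1 →
      (hardCoreLatticeGas 2 (2 * (j + 1)) lam - (B : ℂ) • totalSpin 1 0) *ᵥ ΦB =
        ((hardCoreLatticeGas 2 (2 * (j + 1)) lam - (B : ℂ) • totalSpin 1 0).groundEnergy : ℂ) • ΦB →
      Real.sqrt (1 / 250) - ε ≤
        (star ΦB ⬝ᵥ (totalSpin 1 0 *ᵥ ΦB)).re / (Fintype.card (TorusSite 2 (2 * (j + 1))) : ℝ) := by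
  have hseq := (tendsto_add_atTop_nat 1).eventually (hardCoreLatticeGas_groundState_lroSeq_ge_two hlam hlam')
  have hlro := eventually_le_of_eventually_le_lroSeq (d := 2) hseq
  have ha : (0 : ℝ) < 1 / 250 / 2 := by norm_num
  have h := ground_order_ge_sqrt_two_of_eventually_lro (lam := lam) (fun j => 2 * (j + 1))
    (fun j => fun _ : TorusSite 2 (2 * (j + 1)) => 0) ha (tendsto_card_torusSite_two_mul_succ one_le_two) hlro hB hε
  simp only [stagSpin_zero_eq_totalSpin] at h
  rw [show (1 / 250 / 2 : ℝ) = 1 / 500 by norm_num, sqrt_two_mul_sqrt] at h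
  exact h

/-- **Tracial form**: under the hypotheses of `hardCoreLatticeGas_ground_spontaneousBEC`, for every `B > 0`, `ε > 0`,
eventually on the even tori the uniform mixture `ω_{GS,B}` of the ground states of `H - B·Sˣ_tot` has
`N⁻¹Re ω_{GS,B}(Sˣ_tot) ≥ √2 σ - ε`. [cite: KomaTasaki1993, Theorem 7.3 (7.11), §1 (1.9)] [cite: Tasaki2020, §2.1] -/
theorem hardCoreLatticeGas_ground_spontaneousBEC_groundStateFunctional (hd : 2 ≤ d) :
    ∃ lam₀ : ℝ, 0 < lam₀ ∧ ∀ lam : ℝ, 0 ≤ lam → lam < lam₀ →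
      ∃ σ : ℝ, 0 < σ ∧ ∀ B : ℝ, 0 < B → ∀ ε : ℝ, 0 < ε → ∀ᶠ j : ℕ in atTop,
        Real.sqrt 2 * σ - ε ≤
          ((hardCoreLatticeGas d (2 * (j + 1)) lam - (B : ℂ) • totalSpin 1 0).groundStateFunctional
              (totalSpin 1 0)).re / (Fintype.card (TorusSite d (2 * (j + 1))) : ℝ) := by
  obtain ⟨lam₀, hlam₀, h⟩ := hardCoreLatticeGas_ground_spontaneousBEC hd
  refine ⟨lam₀, hlam₀, fun lam hlam hlamlt => ?_⟩
  obtain ⟨σ, hσ, h⟩ := h lam hlam hlamlt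
  refine ⟨σ, hσ, fun B hB ε hε => (h B hB ε hε).mono fun j hj => ?_⟩
  have hHB : (hardCoreLatticeGas d (2 * (j + 1)) lam - (B : ℂ) • totalSpin 1 0).IsHermitian :=
    (hardCoreLatticeGas_isHermitian d _ lam).sub ((totalSpin_isHermitian 1 0).smul
      (by rw [isSelfAdjoint_iff, Complex.star_def, Complex.conj_ofReal]))
  exact le_re_groundStateFunctional_div_of_forall_groundState hHB _ (Nat.cast_nonneg _) hj

/-- **Tracial form, `d = 2`, explicit**: for `0 ≤ λ ≤ 1/40`, `B > 0`, `ε > 0`, eventually on `(ℤ/2(j+1)ℤ)²`,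
`N⁻¹Re ω_{GS,B}(Sˣ_tot) ≥ √(1/250) - ε`. [cite: KomaTasaki1993, Theorem 7.3 (7.11), §1 (1.9)]
[cite: AizenmanEtAl2004, §2] -/
theorem hardCoreLatticeGas_ground_spontaneousBEC_groundStateFunctional_two {lam : ℝ} (hlam : 0 ≤ lam)
    (hlam' : lam ≤ 1 / 40) {B ε : ℝ} (hB : 0 < B) (hε : 0 < ε) :
    ∀ᶠ j : ℕ in atTop, Real.sqrt (1 / 250) - ε ≤
      ((hardCoreLatticeGas 2 (2 * (j + 1)) lam - (B : ℂ) • totalSpin 1 0).groundStateFunctional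
          (totalSpin 1 0)).re / (Fintype.card (TorusSite 2 (2 * (j + 1))) : ℝ) := by
  refine (hardCoreLatticeGas_ground_spontaneousBEC_two hlam hlam' hB hε).mono fun j hj => ?_
  have hHB : (hardCoreLatticeGas 2 (2 * (j + 1)) lam - (B : ℂ) • totalSpin 1 0).IsHermitian :=
    (hardCoreLatticeGas_isHermitian 2 _ lam).sub ((totalSpin_isHermitian 1 0).smul
      (by rw [isSelfAdjoint_iff, Complex.star_def, Complex.conj_ofReal]))
  exact le_re_groundStateFunctional_div_of_forall_groundState hHB _ (Nat.cast_nonneg _) hj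

/-- **Zero-temperature-limit form** (the `β → ∞` limit inside KT93 (1.9) taken before `Λ↑ℤ^d`): under the hypotheses
of `hardCoreLatticeGas_ground_spontaneousBEC`, for every `B > 0`, `ε > 0`, eventually on the even tori,
`lim_{β→∞}N⁻¹Re⟨Sˣ_tot⟩_{β,H-B·Sˣ_tot}` exists and is `≥ √2 σ - ε`.
[cite: KomaTasaki1993, §1 (1.9), §7 (p. 209), Theorem 7.3] [cite: Tasaki2020, App. A.2] -/
theorem hardCoreLatticeGas_ground_spontaneousBEC_zeroTemperature (hd : 2 ≤ d) :
    ∃ lam₀ : ℝ, 0 < lam₀ ∧ ∀ lam : ℝ, 0 ≤ lam → lam < lam₀ →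
      ∃ σ : ℝ, 0 < σ ∧ ∀ B : ℝ, 0 < B → ∀ ε : ℝ, 0 < ε → ∀ᶠ j : ℕ in atTop, ∃ m : ℝ,
        Tendsto (fun β : ℝ => (gibbsState β (hardCoreLatticeGas d (2 * (j + 1)) lam - (B : ℂ) • totalSpin 1 0)
            (totalSpin 1 0)).re / (Fintype.card (TorusSite d (2 * (j + 1))) : ℝ)) atTop (𝓝 m) ∧
        Real.sqrt 2 * σ - ε ≤ m := by
  obtain ⟨lam₀, hlam₀, h⟩ := hardCoreLatticeGas_ground_spontaneousBEC_groundStateFunctional hd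
  refine ⟨lam₀, hlam₀, fun lam hlam hlamlt => ?_⟩
  obtain ⟨σ, hσ, h⟩ := h lam hlam hlamlt
  refine ⟨σ, hσ, fun B hB ε hε => (h B hB ε hε).mono fun j hj => ⟨_, ?_, hj⟩⟩
  have hHB : (hardCoreLatticeGas d (2 * (j + 1)) lam - (B : ℂ) • totalSpin 1 0).IsHermitian :=
    (hardCoreLatticeGas_isHermitian d _ lam).sub ((totalSpin_isHermitian 1 0).smul
      (by rw [isSelfAdjoint_iff, Complex.star_def, Complex.conj_ofReal]))
  exact ((Complex.continuous_re.tendsto _).comp (Matrix.tendsto_gibbsState_atTop_holds hHB _)).div_const _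

/-- **Zero-temperature-limit form, `d = 2`, explicit**: for `0 ≤ λ ≤ 1/40`, `B > 0`, `ε > 0`, eventually on
`(ℤ/2(j+1)ℤ)²`, `lim_{β→∞}N⁻¹Re⟨Sˣ_tot⟩_{β,H-B·Sˣ_tot}` exists and is `≥ √(1/250) - ε`.
[cite: KomaTasaki1993, §1 (1.9), Theorem 7.3] [cite: AizenmanEtAl2004, §2] -/
theorem hardCoreLatticeGas_ground_spontaneousBEC_zeroTemperature_two {lam : ℝ} (hlam : 0 ≤ lam)
    (hlam' : lam ≤ 1 / 40) {B ε : ℝ} (hB : 0 < B) (hε : 0 < ε) :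
    ∀ᶠ j : ℕ in atTop, ∃ m : ℝ,
      Tendsto (fun β : ℝ => (gibbsState β (hardCoreLatticeGas 2 (2 * (j + 1)) lam - (B : ℂ) • totalSpin 1 0)
          (totalSpin 1 0)).re / (Fintype.card (TorusSite 2 (2 * (j + 1))) : ℝ)) atTop (𝓝 m) ∧
      Real.sqrt (1 / 250) - ε ≤ m := by
  refine (hardCoreLatticeGas_ground_spontaneousBEC_groundStateFunctional_two hlam hlam' hB hε).mono
    fun j hj => ⟨_, ?_, hj⟩
  have hHB : (hardCoreLatticeGas 2 (2 * (j + 1)) lam - (B : ℂ) • totalSpin 1 0).IsHermitian :=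
    (hardCoreLatticeGas_isHermitian 2 _ lam).sub ((totalSpin_isHermitian 1 0).smul
      (by rw [isSelfAdjoint_iff, Complex.star_def, Complex.conj_ofReal]))
  exact ((Complex.continuous_re.tendsto _).comp (Matrix.tendsto_gibbsState_atTop_holds hHB _)).div_const _

/-- **The symmetric side (KT93 Theorem 7.1 context, "obscured symmetry breaking")**: WITHOUT the gauge-breaking field
the tracial ground state of the hard-core gas shows no condensate amplitude on any torus, `N⁻¹Re ω_GS(Sˣ_tot) = 0`
(`ω_GS(Sˣ_x) = 0` for every `x` by the half-turn symmetry about the `z`-axis, the tree's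
`groundStateFunctional_siteSpin_zero_eq_zero`) — although `ω_GS((Sˣ_tot)²) ≥ σ²N²`.
[cite: KomaTasaki1993, §7 Theorem 7.1 and the paragraph before (7.1)] [cite: AizenmanEtAl2004, §4 ("zero by symmetry")] -/
theorem hardCoreLatticeGas_ground_order_eq_zero (L : ℕ) [NeZero L] (lam : ℝ) :
    ((hardCoreLatticeGas d L lam).groundStateFunctional (totalSpin 1 0)).re /
        (Fintype.card (TorusSite d L) : ℝ) = 0 := by
  rw [totalSpin, map_sum, Complex.re_sum, Finset.sum_eq_zero fun x _ => ?_, zero_div]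
  rw [groundStateFunctional_siteSpin_zero_eq_zero L lam x, Complex.zero_re]

end Models

end HardCoreKT

end Literature.MathematicalPhysics.QuantumLattice
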